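import Summits.Parity.GeneralizedHardyLittlewood.Theorems.LeeYangFibresCellParityLawSavingEngineDefs
import Summits.Parity.GeneralizedHardyLittlewood.Theorems.LeeYangFibresCellParityLawGeThreeReduce
import Summits.Parity.GeneralizedHardyLittlewood.Theorems.LeeYangFibresCellParityLawSavingWalshStep
import HarnessLib

/-!
# Route `LeeYangFibres`, crux `CellParityLawSaving` (stmt-Parity-18104), line `superpoly-band-same-atom`
# (payload slug `SketchIdeator3`): the registered stub `stub_reduceAlong` — the kernel applied ALONG THE SCHEDULE

We prove the registered stub `stub_reduceAlong : ReduceAlong` of skeleton v2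
(`Cruxes/CellParityLawSaving/Lines/SketchIdeator3.lean`; vocabulary
`LeeYangFibresCellParityLawSavingEngineDefs`):

  `ReduceAlong : (∃ a > 0, SuperPolyRoughCellLaw a) → (∀ t ≥ 1, KernelReadySavAt t) → ∀ t ≥ 1, RawSectionLawSavAt t`.

This is the sister crux's landed `stub_geThreeReduce` (`LeeYangFibresCellParityLawGeThreeReduce`, the abstract
kernel applied to the Bombieri-normalised localised section sequence) run ALONG THE ROUGHNESS SCHEDULE
`u = U(N) = slowDegree N` with the kernel `SuperPolyRoughCellLaw a` (Bombieri's rough-cell law for one sifted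
sequence, UNIFORM in `2 ≤ u ≤ √(log log x)`, rate `exp(C u²) exp(-c η^{-a})` in the level deficit `η`) and a
log-power saving `(log N)^{-δ}`, `δ := min(κ, 1)/4`.

* Constants. Fix `t ≥ 1` and `L ≥ 1` (`L = 0` is vacuous: a non-degenerate system has size `≥ 1`). The instance
  `(A, B₂) = (0, 1)` of `KernelReadySavAt t` supplies the density constant `L'₀ = L'(t, L)`; the kernel at
  `(A₁, L') = (t + 2, L'₀)` supplies `c, κ, C, A₂, x₀` — BEFORE any roughness is chosen (uniformity in `u` is the
  point of `SuperPolyRoughCellLaw`). Then `B₂ := ⌈2/a⌉₊ + 1` (so `a B₂ ≥ 2`), `A := A₂ + t + 3`, and the working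
  instance of `KernelReadySavAt t` at `(A, B₂)` supplies the ranges (including `U(N) ≤ √(log log x)`), the weights,
  size, density bound, Type-I bound and the three identifications (cells, fibre mass, `V(N^{1/U})`).
* Error terms, with `ℓ = log N`, `ℓℓ = log ℓ`, `U = U(N)`, `4U² ≤ ℓℓ` (`exp(4U²) ≤ ℓ`, `quantClip_schedule`):
  (i) `η^{-a} = (ℓℓ^{B₂}/2)^a ≥ ℓℓ²/2^a` and `C U² ≤ C ℓℓ`, so once `ℓℓ ≥ (C+2) 2^a/c` the exponent
  `C U² - c η^{-a}` is `≤ -2ℓℓ` and `C exp(CU²) exp(-cη^{-a}) ≤ C/ℓ² ≤ 1/(4ℓ^δ)` (`4C ≤ ℓ`, `δ ≤ 1`);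
  (ii) `log z = ℓ/U` and `U ≤ √ℓ`, so `(log z)^{-κ} = (U/ℓ)^κ ≤ ℓ^{-κ/2}` and `C ℓ^{-κ/2} ≤ 1/(4ℓ^δ)` once
  `4C ≤ ℓ^{κ/4}` (`δ ≤ κ/4`);
  (iii) `log(2Λ)/log z = U log(2ℓ^{t+2})/ℓ ≤ (t+3) ℓℓ²/ℓ` (`U ≤ ℓℓ`), and `4C(t+3) ℓℓ² ℓ^δ ≤ ℓ^{1/4} ℓ^{1/4} ℓ^{1/2}`
  once `ℓℓ² ≤ ℓ^{1/4}`, `4C(t+3) ≤ ℓ^{1/4}` (`δ ≤ 1/2`);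
  (iv) `C (log x)^{A₂} R ≤ N/log^{t+2} N` for `A = A₂ + t + 3` (`GeThreeReduceAux.eventually_R_term`, verbatim).
  Hence `C((i)+(ii)+(iii)) V F + (iv) ≤ (3/4) V F/ℓ^δ + N/ℓ^{t+2} ≤ V F/ℓ^δ + N/ℓ^{t+2}`.
  All thresholds (`WalshStepSavAux.exists_thresholds`, `PrLawTwoAssemblyAux.eventually_le_loglog`) depend on
  `t, L, a, c, κ, C, A₂, x₀` only — not on the `N`-dependent roughness.

No number theory is used beyond the two hypotheses; no named fact is used.

References: E. Bombieri, *The asymptotic sieve*, Rend. Accad. Naz. XL (5) 1/2 (1975/76) 243–269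
[BombieriAsymptoticSieve1976]; E. Bombieri, RIMS Kôkyûroku 294 (1977) p. 5 [BombieriRIMS1977]; J. Friedlander,
H. Iwaniec, Ann. Sc. Norm. Sup. Pisa (4) 5 (1978) §4 [FriedlanderIwaniecPisa1978]; K. Ford, Trans. AMS 357 (2005)
[Ford2004]; K. Alladi, Quart. J. Math. 33 (1982) [Alladi1982].
-/

noncomputable section

open scoped BigOperators Classical
open Finset Filter Literature.NumberTheory.Sieve
open Summit.Parity.GeneralizedHardyLittlewood.Cruxes.CellParityLaw.SectionAnnihilator
open Summit.Parity.GeneralizedHardyLittlewood.Cruxes.AbsoluteUpgrade.DipMarginRateExchange (slowDegree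
  four_le_slowDegree quantClip_schedule)

namespace Summit.Parity.GeneralizedHardyLittlewood.Cruxes.CellParityLawSaving.SuperPolyBand

namespace ReduceAlongAux

/-- The deficit bookkeeping: for `ℓℓ ≥ 1` and `a B₂ ≥ 2`, `ℓℓ²/2^a ≤ (2/ℓℓ^{B₂})^{-a}`
(`(2/ℓℓ^{B₂})^{-a} = (ℓℓ^{B₂})^a/2^a = ℓℓ^{a B₂}/2^a`). -/
theorem sq_div_le_eta_rpow_neg {ℓℓ a : ℝ} {B₂ : ℕ} (hℓℓ : 1 ≤ ℓℓ) (hB : 2 ≤ a * B₂) :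
    ℓℓ ^ 2 / 2 ^ a ≤ (2 / ℓℓ ^ B₂) ^ (-a) := by
  have hℓℓ0 : 0 < ℓℓ := by linarith
  have hpow0 : 0 < ℓℓ ^ B₂ := pow_pos hℓℓ0 _
  rw [Real.rpow_neg (div_pos two_pos hpow0).le, Real.div_rpow zero_le_two hpow0.le, inv_div]
  refine div_le_div_of_nonneg_right ?_ (Real.rpow_pos_of_pos two_pos a).le
  calc ℓℓ ^ 2 = ℓℓ ^ (2 : ℝ) := (Real.rpow_two ℓℓ).symm
    _ ≤ ℓℓ ^ ((B₂ : ℝ) * a) := Real.rpow_le_rpow_of_exponent_le hℓℓ (hB.trans_eq (mul_comm _ _))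
    _ = (ℓℓ ^ B₂) ^ a := by rw [Real.rpow_mul hℓℓ0.le, Real.rpow_natCast]

/-- **Term (i) along the schedule.** With `ℓ = log N ≥ 1`, `4U² ≤ log ℓ`, `E = η^{-a} ≥ (log ℓ)²/2^a`,
`log ℓ ≥ (C+2)2^a/c` and `4C ≤ ℓ`: the exponent `C U² - c E` is `≤ -2 log ℓ`, so
`C e^{CU²} e^{-cE} ≤ C/ℓ² ≤ 1/(4ℓ^δ)` (`δ ≤ 1`). -/
theorem exp_term_le {C c a δ ℓ U E : ℝ} (hC : 0 ≤ C) (hc : 0 < c) (hℓ : 1 ≤ ℓ) (hδ : δ ≤ 1)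
    (hU : 4 * U ^ 2 ≤ Real.log ℓ) (hE : Real.log ℓ ^ 2 / 2 ^ a ≤ E)
    (hℓℓ : (C + 2) * 2 ^ a / c ≤ Real.log ℓ) (h4C : 4 * C ≤ ℓ) :
    C * (Real.exp (C * U ^ 2) * Real.exp (-(c * E))) ≤ 1 / (4 * ℓ ^ δ) := by
  have hℓ0 : 0 < ℓ := by linarith
  have hℓℓ0 : 0 ≤ Real.log ℓ := Real.log_nonneg hℓ
  have h2a : 0 < (2 : ℝ) ^ a := Real.rpow_pos_of_pos two_pos a
  -- `C U² ≤ C log ℓ`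
  have h1 : C * U ^ 2 ≤ C * Real.log ℓ :=
    mul_le_mul_of_nonneg_left (by linarith [sq_nonneg U]) hC
  -- `(C + 2) log ℓ ≤ c E`
  have h2 : (C + 2) * Real.log ℓ ≤ c * E := by
    have h3 : (C + 2) * 2 ^ a ≤ c * Real.log ℓ := by
      have := (div_le_iff₀ hc).1 hℓℓ
      linarith
    have h4 : (C + 2) * Real.log ℓ ≤ c * (Real.log ℓ ^ 2 / 2 ^ a) := by
      rw [mul_div_assoc', le_div_iff₀ h2a]
      calc (C + 2) * Real.log ℓ * 2 ^ a = (C + 2) * 2 ^ a * Real.log ℓ := by ring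
        _ ≤ c * Real.log ℓ * Real.log ℓ := mul_le_mul_of_nonneg_right h3 hℓℓ0
        _ = c * Real.log ℓ ^ 2 := by ring
    exact h4.trans (mul_le_mul_of_nonneg_left hE hc.le)
  -- the exponent is `≤ -2 log ℓ`, so the product of exponentials is `≤ 1/ℓ²`
  have h5 : Real.exp (C * U ^ 2) * Real.exp (-(c * E)) ≤ 1 / ℓ ^ 2 := by
    rw [← Real.exp_add]
    calc Real.exp (C * U ^ 2 + -(c * E)) ≤ Real.exp (-(Real.log ℓ + Real.log ℓ)) := by
          rw [Real.exp_le_exp]; linarith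
      _ = 1 / ℓ ^ 2 := by
          rw [Real.exp_neg, Real.exp_add, Real.exp_log hℓ0, one_div, sq]
  -- `C/ℓ² ≤ 1/(4ℓ^δ)` since `4Cℓ^δ ≤ ℓ · ℓ`
  have hℓδ0 : 0 < ℓ ^ δ := Real.rpow_pos_of_pos hℓ0 δ
  have hℓδ : ℓ ^ δ ≤ ℓ := by
    calc ℓ ^ δ ≤ ℓ ^ (1 : ℝ) := Real.rpow_le_rpow_of_exponent_le hℓ hδ
      _ = ℓ := Real.rpow_one ℓ
  calc C * (Real.exp (C * U ^ 2) * Real.exp (-(c * E))) ≤ C * (1 / ℓ ^ 2) :=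
        mul_le_mul_of_nonneg_left h5 hC
    _ = C / ℓ ^ 2 := by ring
    _ ≤ 1 / (4 * ℓ ^ δ) := by
        rw [div_le_div_iff₀ (by positivity) (by positivity)]
        calc C * (4 * ℓ ^ δ) = 4 * C * ℓ ^ δ := by ring
          _ ≤ ℓ * ℓ := mul_le_mul h4C hℓδ hℓδ0.le hℓ0.le
          _ = 1 * ℓ ^ 2 := by ring

/-- **Term (ii) along the schedule.** With `ℓ = log N ≥ 1`, `log z = ℓ/U`, `1 ≤ U`, `4U² ≤ log ℓ` (so
`U ≤ √ℓ`), `δ ≤ κ/4` and `4C ≤ ℓ^{κ/4}`: `(log z)^{-κ} = (U/ℓ)^κ ≤ ℓ^{-κ/2}` and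
`C ℓ^{-κ/2} ≤ 1/(4ℓ^δ)`. -/
theorem logz_term_le {C κ δ ℓ U : ℝ} (hC : 0 ≤ C) (hκ : 0 < κ) (hℓ : 1 ≤ ℓ) (hU1 : 1 ≤ U)
    (hU : 4 * U ^ 2 ≤ Real.log ℓ) (hδ : δ ≤ κ / 4) (h4C : 4 * C ≤ ℓ ^ (κ / 4)) :
    C * (1 / U * ℓ) ^ (-κ) ≤ 1 / (4 * ℓ ^ δ) := by
  have hℓ0 : 0 < ℓ := by linarith
  have hU0 : 0 < U := by linarith
  have hlz : 0 < 1 / U * ℓ := by positivity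
  -- `U ≤ √ℓ`: `U² ≤ (log ℓ)/4 ≤ log ℓ ≤ ℓ`
  have hUℓ : U ^ 2 ≤ ℓ := by
    have := Real.log_le_sub_one_of_pos hℓ0
    linarith [sq_nonneg U]
  have hUs : U ≤ Real.sqrt ℓ := Real.le_sqrt_of_sq_le hUℓ
  -- `(log z)⁻¹ = U/ℓ ≤ ℓ^{-1/2}`
  have hinv : (1 / U * ℓ)⁻¹ ≤ ℓ ^ (-(1 / 2 : ℝ)) := by
    rw [Real.rpow_neg hℓ0.le, ← Real.sqrt_eq_rpow]
    refine inv_anti₀ (Real.sqrt_pos.2 hℓ0) ?_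
    rw [one_div, inv_mul_eq_div, le_div_iff₀ hU0]
    calc Real.sqrt ℓ * U ≤ Real.sqrt ℓ * Real.sqrt ℓ :=
          mul_le_mul_of_nonneg_left hUs (Real.sqrt_nonneg ℓ)
      _ = ℓ := Real.mul_self_sqrt hℓ0.le
  have hzκ : (1 / U * ℓ) ^ (-κ) ≤ ℓ ^ (-(κ / 2)) := by
    calc (1 / U * ℓ) ^ (-κ) ≤ (ℓ ^ (-(1 / 2 : ℝ))) ^ κ :=
          GeThreeReduceAux.log_rpow_neg_le hlz hκ.le hinv
      _ = ℓ ^ (-(κ / 2)) := by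
          rw [← Real.rpow_mul hℓ0.le]
          congr 1
          ring
  have hℓδ0 : 0 < ℓ ^ δ := Real.rpow_pos_of_pos hℓ0 δ
  have hq0 : 0 < ℓ ^ (κ / 4) := Real.rpow_pos_of_pos hℓ0 _
  have hℓδ : ℓ ^ δ ≤ ℓ ^ (κ / 4) := Real.rpow_le_rpow_of_exponent_le hℓ hδ
  calc C * (1 / U * ℓ) ^ (-κ) ≤ C * ℓ ^ (-(κ / 2)) := mul_le_mul_of_nonneg_left hzκ hC
    _ = C / ℓ ^ (κ / 2) := by rw [Real.rpow_neg hℓ0.le, ← div_eq_mul_inv]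
    _ ≤ 1 / (4 * ℓ ^ δ) := by
        rw [div_le_div_iff₀ (Real.rpow_pos_of_pos hℓ0 _) (by positivity)]
        calc C * (4 * ℓ ^ δ) = 4 * C * ℓ ^ δ := by ring
          _ ≤ ℓ ^ (κ / 4) * ℓ ^ (κ / 4) := mul_le_mul h4C hℓδ hℓδ0.le hq0.le
          _ = ℓ ^ (κ / 4 + κ / 4) := (Real.rpow_add hℓ0 _ _).symm
          _ = 1 * ℓ ^ (κ / 2) := by rw [one_mul, show κ / 4 + κ / 4 = κ / 2 by ring]

/-- **Term (iii) along the schedule.** With `ℓ = log N > 1`, `log z = ℓ/U`, `1 ≤ U ≤ log ℓ`, `δ ≤ 1/2`,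
`(log ℓ)² ≤ ℓ^{1/4}` and `4C(t+3) ≤ ℓ^{1/4}`: `log(2ℓ^{t+2}) ≤ (t+3) log ℓ`, so
`C log(2Λ)/log z ≤ C (t+3) U log ℓ/ℓ ≤ C (t+3) (log ℓ)²/ℓ ≤ 1/(4ℓ^δ)`. -/
theorem lam_term_le {C δ ℓ U : ℝ} (t : ℕ) (hC : 0 ≤ C) (hℓ : 1 < ℓ) (hU1 : 1 ≤ U)
    (hU : U ≤ Real.log ℓ) (hδ : δ ≤ 1 / 2)
    (hll : Real.log ℓ ^ 2 ≤ ℓ ^ (1 / 4 : ℝ)) (h4C : 4 * C * ((t : ℝ) + 3) ≤ ℓ ^ (1 / 4 : ℝ)) :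
    C * (Real.log (2 * ℓ ^ (t + 2)) / (1 / U * ℓ)) ≤ 1 / (4 * ℓ ^ δ) := by
  have hℓ0 : 0 < ℓ := by linarith
  have hℓ1 : 1 ≤ ℓ := hℓ.le
  have hU0 : 0 < U := by linarith
  have hℓℓ1 : 1 ≤ Real.log ℓ := hU1.trans hU
  have hℓℓ0 : 0 < Real.log ℓ := by linarith
  -- `log (2 ℓ^{t+2}) = log 2 + (t+2) log ℓ ≤ (t+3) log ℓ`
  have hlog2 : Real.log 2 ≤ Real.log ℓ := by
    have := Real.log_two_lt_d9
    linarith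
  have hlam : Real.log (2 * ℓ ^ (t + 2)) ≤ ((t : ℝ) + 3) * Real.log ℓ := by
    rw [Real.log_mul (by norm_num) (pow_pos hℓ0 _).ne', Real.log_pow]
    push_cast
    nlinarith
  have hlam0 : 0 ≤ Real.log (2 * ℓ ^ (t + 2)) :=
    Real.log_nonneg (by nlinarith [one_le_pow₀ (M₀ := ℝ) (a := ℓ) (n := t + 2) hℓ1])
  have hden : 0 < 1 / U * ℓ := by positivity
  have hℓδ0 : 0 < ℓ ^ δ := Real.rpow_pos_of_pos hℓ0 δ
  have hh0 : 0 < ℓ ^ (1 / 2 : ℝ) := Real.rpow_pos_of_pos hℓ0 _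
  have hq0 : 0 < ℓ ^ (1 / 4 : ℝ) := Real.rpow_pos_of_pos hℓ0 _
  have hℓδ : ℓ ^ δ ≤ ℓ ^ (1 / 2 : ℝ) := Real.rpow_le_rpow_of_exponent_le hℓ1 hδ
  -- `U log ℓ ≤ (log ℓ)² ≤ ℓ^{1/4}`
  have hUll : U * Real.log ℓ ≤ ℓ ^ (1 / 4 : ℝ) := by
    calc U * Real.log ℓ ≤ Real.log ℓ * Real.log ℓ := mul_le_mul_of_nonneg_right hU hℓℓ0.le
      _ = Real.log ℓ ^ 2 := (sq _).symm
      _ ≤ ℓ ^ (1 / 4 : ℝ) := hll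
  rw [le_div_iff₀ (by positivity)]
  calc C * (Real.log (2 * ℓ ^ (t + 2)) / (1 / U * ℓ)) * (4 * ℓ ^ δ)
      ≤ C * (((t : ℝ) + 3) * Real.log ℓ / (1 / U * ℓ)) * (4 * ℓ ^ δ) := by gcongr
    _ = 4 * C * ((t : ℝ) + 3) * (U * Real.log ℓ) * ℓ ^ δ / ℓ := by
        field_simp
    _ ≤ ℓ ^ (1 / 4 : ℝ) * ℓ ^ (1 / 4 : ℝ) * ℓ ^ (1 / 2 : ℝ) / ℓ := by
        gcongr
    _ = 1 := by
        rw [← Real.rpow_add hℓ0, ← Real.rpow_add hℓ0, show (1 / 4 : ℝ) + 1 / 4 + 1 / 2 = 1 by norm_num,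
          Real.rpow_one, div_self hℓ0.ne']

end ReduceAlongAux

open GeThreeReduceAux PrLawTwoAssemblyAux ReduceAlongAux in
/-- **`stub_reduceAlong`** (registered stub of skeleton v2, line `superpoly-band-same-atom`): the kernel
`SuperPolyRoughCellLaw a` applied along the schedule `u = U(N)` at deficit `η = 2(log log N)^{-B₂}`,
`B₂ = ⌈2/a⌉₊ + 1`, with the saving `δ = min(κ, 1)/4` — `ReduceAlong`. -/
theorem stub_reduceAlong : ReduceAlong := by
  rintro ⟨a, ha, hK⟩ hR t ht L
  -- the vacuous case `L = 0`
  rcases Nat.eq_zero_or_pos L with hL0 | hLpos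
  · refine ⟨1, one_pos, 0, fun N _ Ψ hΨ hL K _ _ i => ?_⟩
    have h1 : (1 : ℝ) ≤ (L : ℝ) := one_le_of_affLinSize_le Ψ hΨ hL i
    rw [hL0, Nat.cast_zero] at h1
    exact absurd h1 (by norm_num)
  have hL1 : 1 ≤ L := hLpos
  have hL1r : (1 : ℝ) ≤ L := by exact_mod_cast hL1
  -- the density constant `L'₀` (instance `A = 0`, `B₂ = 1`) and the kernel's constants, chosen BEFORE `u`
  obtain ⟨L'₀, M₀, h0⟩ := hR t ht L 0 1 le_rfl
  obtain ⟨c, κ, C, A₂, x₀, hc, hκ, hC, hKer⟩ := hK ((t : ℝ) + 2) L'₀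
  -- the working instance: `a B₂ ≥ 2`, `A = A₂ + t + 3`
  set B₂ : ℕ := ⌈2 / a⌉₊ + 1 with hB₂
  have hB₂1 : 1 ≤ B₂ := by omega
  have haB : 2 ≤ a * B₂ := by
    have h1 : 2 / a ≤ ⌈2 / a⌉₊ := Nat.le_ceil _
    have h2 : 2 / a ≤ (B₂ : ℝ) := by rw [hB₂]; push_cast; linarith
    rw [div_le_iff₀ ha] at h2
    linarith
  set A : ℕ := A₂ + t + 3 with hAdef
  obtain ⟨L'₁, M₁, h1⟩ := hR t ht L A B₂ hB₂1
  -- the saving `δ = min(κ, 1)/4`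
  set δ : ℝ := min κ 1 / 4 with hδdef
  have hδ0 : 0 < δ := by rw [hδdef]; positivity
  have hδκ : δ ≤ κ / 4 := by rw [hδdef]; linarith [min_le_left κ 1]
  have hδ1 : δ ≤ 1 / 2 := by rw [hδdef]; linarith [min_le_right κ 1]
  have hκ4 : 0 < κ / 4 := by positivity
  -- thresholds (independent of the `N`-dependent roughness)
  obtain ⟨N₁, hN₁⟩ := quantClip_schedule 0
  obtain ⟨N₂, hN₂⟩ := WalshStepSavAux.exists_thresholds (by norm_num : (0 : ℝ) < 1 / 4) hκ4 2 (4 * C)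
  obtain ⟨N₃, hN₃⟩ := WalshStepSavAux.exists_thresholds (by norm_num : (0 : ℝ) < 1 / 4)
    (by norm_num : (0 : ℝ) < 1 / 4) 2 (4 * C * ((t : ℝ) + 3))
  obtain ⟨N₀, hN₀⟩ := Filter.eventually_atTop.1 ((eventually_R_term C hC L A₂ t hL1).and
    ((eventually_le_loglog (max 1 ((C + 2) * 2 ^ a / c))).and
    (((Real.tendsto_log_atTop.comp tendsto_natCast_atTop_atTop).eventually_ge_atTop (4 * C)).and
    ((tendsto_natCast_atTop_atTop.eventually_ge_atTop x₀).and ((eventually_ge_atTop M₀).and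
    ((eventually_ge_atTop M₁).and ((eventually_ge_atTop N₁).and ((eventually_ge_atTop N₂).and
    (eventually_ge_atTop N₃)))))))))
  refine ⟨δ, hδ0, N₀, fun N hN Ψ hΨ hL K hK hKN i j' hj' hlt1 hKT hF0 => ?_⟩
  obtain ⟨hRT, hll, h4Cℓ, hx₀N, hNM₀, hNM₁, hNN₁, hNN₂, hNN₃⟩ := hN₀ N hN
  have h4Cℓ' : 4 * C ≤ Real.log (N : ℝ) := h4Cℓ
  obtain ⟨-, hN16, hexp, -⟩ := hN₁ N hNN₁
  obtain ⟨hℓ1, hll2, h4Cκ⟩ := hN₂ N hNN₂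
  obtain ⟨-, -, h4Ct⟩ := hN₃ N hNN₃
  have hN0 : (0 : ℝ) < N := by exact_mod_cast (by omega : 0 < N)
  have hℓ0 : 0 < Real.log (N : ℝ) := by linarith
  have hℓℓ1 : 1 ≤ Real.log (Real.log (N : ℝ)) := le_trans (le_max_left _ _) hll
  have hℓℓC : (C + 2) * 2 ^ a / c ≤ Real.log (Real.log (N : ℝ)) := le_trans (le_max_right _ _) hll
  -- the schedule: `4 U² ≤ log log N`, hence `1 ≤ U ≤ log log N`
  have hU4 : (4 : ℝ) ≤ (slowDegree N : ℝ) := by exact_mod_cast four_le_slowDegree N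
  have hU1 : (1 : ℝ) ≤ (slowDegree N : ℝ) := by linarith
  have h4U : 4 * (slowDegree N : ℝ) ^ 2 ≤ Real.log (Real.log (N : ℝ)) :=
    (Real.le_log_iff_exp_le hℓ0).2 hexp
  have hUℓℓ : (slowDegree N : ℝ) ≤ Real.log (Real.log (N : ℝ)) := by nlinarith
  -- the two instances of the ready sequence
  obtain ⟨-, -, -, -, -, -, -, hIw0, hlow0, -, -, -, -⟩ :=
    h0 N hNM₀ Ψ hΨ hL K hK hKN i j' hj' hlt1 hKT hF0
  obtain ⟨⟨hsqrt, hz1, hz2, hη1, hη2, hΛ1, hΛ2, hw1, hw2⟩, hwt, hsHi, hsLo, hsize, hszlow, hdensLe, -, -,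
    hTI, hcell, hsizeF, hdens⟩ := h1 N hNM₁ Ψ hΨ hL K hK hKN i j' hj' hlt1 hKT hF0
  -- `x₀ ≤ x = 2LN`
  have hx₀ : x₀ ≤ xOf L N := by
    refine le_trans hx₀N ?_
    change (N : ℝ) ≤ 2 * (L : ℝ) * N
    nlinarith
  -- the kernel, at `u := U(N)`
  obtain ⟨δ', hδ'0, hδ'2, hlaw⟩ := hKer (slowDegree N) (secSeqB Ψ K N (slowDegree N) i j') (xOf L N)
    (zOf N (slowDegree N)) (etaOf N B₂) (lamOf N t) (wOf N) (rOf N A)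
    (le_trans (by norm_num) (four_le_slowDegree N)) hx₀ hsqrt hz1 hz2 hη1 hη2 hΛ1 hΛ2 hw1 hw2
    hwt hsHi hsLo hsize hszlow hdensLe hIw0 hlow0 hTI
  refine ⟨δ', hδ'0, hδ'2, fun m hm => ?_⟩
  have hm' := hlaw m hm
  rw [hcell m hm, hsizeF, hdens] at hm'
  refine hm'.trans ?_
  -- notation
  set V : ℝ := ∏ p ∈ Nat.primesBelow ⌈zOf N (slowDegree N)⌉₊, (1 - sectionDensity Ψ i p) with hV
  set F : ℝ := (sectionMass Ψ K N (slowDegree N) i j' 1 : ℝ) with hFdef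
  have hV0 : 0 ≤ V :=
    prod_one_sub_sectionDensity_nonneg Ψ i _ fun p hp => Nat.prime_of_mem_primesBelow hp
  have hF0' : 0 ≤ F := Nat.cast_nonneg _
  have hVF : 0 ≤ V * F := mul_nonneg hV0 hF0'
  -- the three relative error terms
  have hlogz : Real.log (zOf N (slowDegree N)) = 1 / (slowDegree N : ℝ) * Real.log N := by
    change Real.log ((N : ℝ) ^ ((1 : ℝ) / (slowDegree N : ℝ))) = _
    rw [Real.log_rpow hN0]
  have hPδ : 0 < Real.log (N : ℝ) ^ δ := Real.rpow_pos_of_pos hℓ0 δ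
  have hE : Real.log (Real.log (N : ℝ)) ^ 2 / 2 ^ a ≤ etaOf N B₂ ^ (-a) :=
    sq_div_le_eta_rpow_neg hℓℓ1 haB
  have hT1 : C * (Real.exp (C * (slowDegree N : ℝ) ^ 2) * Real.exp (-(c * etaOf N B₂ ^ (-a)))) ≤
      1 / (4 * Real.log (N : ℝ) ^ δ) :=
    exp_term_le hC hc hℓ1.le (by linarith) h4U hE hℓℓC h4Cℓ'
  have hT2 : C * Real.log (zOf N (slowDegree N)) ^ (-κ) ≤ 1 / (4 * Real.log (N : ℝ) ^ δ) := by
    rw [hlogz]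
    exact logz_term_le hC hκ hℓ1.le hU1 h4U hδκ h4Cκ
  have hT3 : C * (Real.log (2 * lamOf N t) / Real.log (zOf N (slowDegree N))) ≤
      1 / (4 * Real.log (N : ℝ) ^ δ) := by
    rw [hlogz]
    exact lam_term_le t hC hℓ1 hU1 hUℓℓ hδ1 hll2 h4Ct
  have h34 : 3 * (1 / (4 * Real.log (N : ℝ) ^ δ)) ≤ 1 / Real.log (N : ℝ) ^ δ := by
    rw [← div_eq_mul_one_div, div_le_div_iff₀ (by positivity) hPδ]
    linarith
  have hrel : C * (Real.exp (C * (slowDegree N : ℝ) ^ 2) * Real.exp (-(c * etaOf N B₂ ^ (-a))) +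
      Real.log (zOf N (slowDegree N)) ^ (-κ) +
      Real.log (2 * lamOf N t) / Real.log (zOf N (slowDegree N))) ≤ 1 / Real.log (N : ℝ) ^ δ := by
    calc C * (Real.exp (C * (slowDegree N : ℝ) ^ 2) * Real.exp (-(c * etaOf N B₂ ^ (-a))) +
          Real.log (zOf N (slowDegree N)) ^ (-κ) +
          Real.log (2 * lamOf N t) / Real.log (zOf N (slowDegree N)))
        = C * (Real.exp (C * (slowDegree N : ℝ) ^ 2) * Real.exp (-(c * etaOf N B₂ ^ (-a)))) +
            C * Real.log (zOf N (slowDegree N)) ^ (-κ) +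
            C * (Real.log (2 * lamOf N t) / Real.log (zOf N (slowDegree N))) := by ring
      _ ≤ 1 / (4 * Real.log (N : ℝ) ^ δ) + 1 / (4 * Real.log (N : ℝ) ^ δ) +
            1 / (4 * Real.log (N : ℝ) ^ δ) := add_le_add (add_le_add hT1 hT2) hT3
      _ = 3 * (1 / (4 * Real.log (N : ℝ) ^ δ)) := by ring
      _ ≤ 1 / Real.log (N : ℝ) ^ δ := h34
  -- the Type-I term
  have hRterm : C * Real.log (xOf L N) ^ A₂ * rOf N A ≤ (N : ℝ) / Real.log N ^ (t + 2) := hRT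
  -- conclusion
  calc C * (Real.exp (C * (slowDegree N : ℝ) ^ 2) * Real.exp (-(c * etaOf N B₂ ^ (-a))) +
          Real.log (zOf N (slowDegree N)) ^ (-κ) +
          Real.log (2 * lamOf N t) / Real.log (zOf N (slowDegree N))) * (V * F) +
        C * Real.log (xOf L N) ^ A₂ * rOf N A
      ≤ 1 / Real.log (N : ℝ) ^ δ * (V * F) + (N : ℝ) / Real.log N ^ (t + 2) :=
        add_le_add (mul_le_mul_of_nonneg_right hrel hVF) hRterm
    _ = V * F / Real.log N ^ δ + (N : ℝ) / Real.log N ^ (t + 2) := by ring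

end Summit.Parity.GeneralizedHardyLittlewood.Cruxes.CellParityLawSaving.SuperPolyBand

end
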